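import Summits.ValiantsHypothesis.ValiantsHypothesis.Theorems.KPlusLogSqLawTropicalBWalkWidth

/-!
# Route `KPlusLogSqLaw`, crux `TropicalB` (stmt-ValiantsHypothesis-19771) — the NARROW-WALK SECTOR LAW, part 3:
# `TropicalB`'s inequality holds on every walk design with `C = 8`

HONEST FRAMING.  Def-free helper (hand leafhand-val-kpluslogsqlaw-1 g33, 2026-09-01; `--supports stmt-ValiantsHypothesis-19771 --as helper`),
a one-theorem corollary of `WalkDesign.chain_le_width` (`…TropicalBWalkWidth`): for the walk design of ANY layered graph (any width `W = |V|`,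
any `T ≥ 1`, any class count `K` and exponent table `d`), every chain of dominant terms at strictly increasing integer slopes with distinct
consecutive terms has `n ≤ 2^(8·(K + ⌊log₂ m⌋²))`, `m = (T+1)·W` the number of rows — the inequality of the crux `TropicalB` with the absolute
constant `8` (and without using `K`).  So the WALK SECTOR, which carries every super-polynomial lower-bound family the route knows (staircase /
Carstensen–Mulmuley–Shah), satisfies the crux's inequality outright; compare the Hessenberg sector (`tropicalB_hessenberg`, `C = 30`), a
different embedding of path families (consecutive-cycle supports) — walk designs close their walks by one long back cycle and are not Hessenberg.
`TropicalB` on general supports stays OPEN; nothing here bears on `WeakLifting`, `MatrixDescartes` (stmt-ValiantsHypothesis-18050) or VP ≠ VNP.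
[folklore: `chain_le_width` + `W ≤ m`, `T ≤ m`, `⌈log₂ T⌉ ≤ ⌊log₂ m⌋ + 1`]
-/

set_option linter.dupNamespace false
set_option autoImplicit false

namespace Summit.ValiantsHypothesis.ValiantsHypothesis.Theorems.KPlusLogSqLaw.WalkDesign

open Summit.ValiantsHypothesis.ValiantsHypothesis.Theorems.MatrixDescartes.Negative
open Summit.ValiantsHypothesis.ValiantsHypothesis.Theorems.SymmetroidDescartes.DPR

variable {V : Type*} [DecidableEq V] [Fintype V] {T K : ℕ} (lay : Fin T → V → V → Option (WEdge K)) (d : Fin K → ℕ)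
  (v₀ : V) (l₀ : Fin K) {m : ℕ} (ι : Fin (T + 1) × V ≃ Fin m) (Ω : ℤ)

/-- **`TropicalB`'s inequality holds on EVERY walk design, with the absolute constant `C = 8` and no use of `K`:**
`n ≤ 2^(8·(K + ⌊log₂ m⌋²))` for every sign-alternating / consecutive-distinct dominant chain of a walk design of any width
(`W ≤ m`, `T ≤ m`, `⌈log₂ T⌉ ≤ ⌊log₂ m⌋ + 1`, so `W·(2W)^⌈log₂ T⌉ ≤ 2^((⌊log₂ m⌋+1)(⌊log₂ m⌋+3))`).  The walk sector — which carries every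
super-polynomial family the route knows — thus satisfies the crux's inequality outright (compare the Hessenberg sector, `tropicalB_hessenberg`,
`C = 30`, a different embedding of path families); `TropicalB` on general supports stays open. [folklore: `chain_le_width` + arithmetic] -/
theorem chain_le_kPlusLogSq (hT : 0 < T) {n : ℕ} (θ : Fin (n + 1) → ℤ)
    (p : Fin (n + 1) → Equiv.Perm (Fin m) × (Fin m → Fin K)) (hθ : StrictMono θ)
    (hdom : ∀ k, IsDominant d (walkVal ι lay Ω v₀) (walkEps ι lay l₀ v₀) (θ k) (p k))
    (hne : ∀ k : Fin n, p k.castSucc ≠ p k.succ) : n ≤ 2 ^ (8 * (K + Nat.log 2 m ^ 2)) := by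
  have h := chain_le_width lay d v₀ l₀ ι Ω hT θ p hθ hdom hne
  set c := Nat.clog 2 T with hc
  set W := Fintype.card V with hW
  have hm : (T + 1) * W = m := card_eq_of_equiv ι
  have hK : 1 ≤ K := l₀.pos
  have hW1 : 1 ≤ W := Fintype.card_pos_iff.2 ⟨v₀⟩
  have hWm : W ≤ m := by nlinarith
  have hTm : T ≤ m := by nlinarith
  set L := Nat.log 2 m with hL
  have hm2 : m < 2 ^ (L + 1) := Nat.lt_pow_succ_log_self one_lt_two m
  have hcL : c ≤ L + 1 := (Nat.clog_le_iff_le_pow one_lt_two).2 (by omega)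
  -- `W·(2W)^c ≤ 2^(L+1) · (2^(L+2))^(L+1) = 2^((L+1)(L+3))`
  have h1 : W * (2 * W) ^ c ≤ 2 ^ (L + 1) * (2 ^ (L + 2)) ^ (L + 1) := by
    refine Nat.mul_le_mul (by omega) ?_
    calc (2 * W) ^ c ≤ (2 ^ (L + 2)) ^ c := Nat.pow_le_pow_left (by rw [pow_succ]; omega) c
      _ ≤ (2 ^ (L + 2)) ^ (L + 1) := Nat.pow_le_pow_right (Nat.one_le_two_pow) hcL
  have h2 : 2 ^ (L + 1) * (2 ^ (L + 2)) ^ (L + 1) = 2 ^ ((L + 1) * (L + 3)) := by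
    rw [← pow_mul, ← pow_add]; ring_nf
  have h3 : (L + 1) * (L + 3) ≤ 8 * (K + L ^ 2) := by nlinarith
  have h4 : 2 ^ ((L + 1) * (L + 3)) ≤ 2 ^ (8 * (K + L ^ 2)) := Nat.pow_le_pow_right (by norm_num) h3
  rw [h2] at h1
  omega


/-- signed form (census currency): the same for sign-alternating dominant chains. [folklore] -/
theorem chain_le_kPlusLogSq_signed (hT : 0 < T) {n : ℕ} (θ : Fin (n + 1) → ℤ)
    (p : Fin (n + 1) → Equiv.Perm (Fin m) × (Fin m → Fin K)) (hθ : StrictMono θ)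
    (hdom : ∀ k, IsDominant d (walkVal ι lay Ω v₀) (walkEps ι lay l₀ v₀) (θ k) (p k))
    (halt : ∀ k : Fin n, termSign (walkEps ι lay l₀ v₀) (p k.castSucc) * termSign (walkEps ι lay l₀ v₀) (p k.succ) < 0) :
    n ≤ 2 ^ (8 * (K + Nat.log 2 m ^ 2)) := by
  refine chain_le_kPlusLogSq lay d v₀ l₀ ι Ω hT θ p hθ hdom fun k h => ?_
  have := halt k
  rw [h] at this
  exact absurd this (not_lt.mpr (mul_self_nonneg _))

/-- **The THIN regime stub's conclusion on the walk sector** (`stub_tropThin` shape, `C = 16`): if `K ≤ ⌊log₂ m⌋²` then every dominant chain of a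
walk design has `n ≤ 2^(16·⌊log₂ m⌋²)`. [folklore: `chain_le_kPlusLogSq` + arithmetic] -/
theorem chain_le_thin (hT : 0 < T) (hK : K ≤ Nat.log 2 m ^ 2) {n : ℕ} (θ : Fin (n + 1) → ℤ)
    (p : Fin (n + 1) → Equiv.Perm (Fin m) × (Fin m → Fin K)) (hθ : StrictMono θ)
    (hdom : ∀ k, IsDominant d (walkVal ι lay Ω v₀) (walkEps ι lay l₀ v₀) (θ k) (p k))
    (hne : ∀ k : Fin n, p k.castSucc ≠ p k.succ) : n ≤ 2 ^ (16 * Nat.log 2 m ^ 2) := by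
  refine (chain_le_kPlusLogSq lay d v₀ l₀ ι Ω hT θ p hθ hdom hne).trans (Nat.pow_le_pow_right (by norm_num) ?_)
  omega

/-- **The FAT regime stub's conclusion on the walk sector** (`stub_tropFat` shape, `C = 16`): if `⌊log₂ m⌋² ≤ K` then every dominant chain of a
walk design has `n ≤ 2^(16·K)`. [folklore: `chain_le_kPlusLogSq` + arithmetic] -/
theorem chain_le_fat (hT : 0 < T) (hK : Nat.log 2 m ^ 2 ≤ K) {n : ℕ} (θ : Fin (n + 1) → ℤ)
    (p : Fin (n + 1) → Equiv.Perm (Fin m) × (Fin m → Fin K)) (hθ : StrictMono θ)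
    (hdom : ∀ k, IsDominant d (walkVal ι lay Ω v₀) (walkEps ι lay l₀ v₀) (θ k) (p k))
    (hne : ∀ k : Fin n, p k.castSucc ≠ p k.succ) : n ≤ 2 ^ (16 * K) := by
  refine (chain_le_kPlusLogSq lay d v₀ l₀ ι Ω hT θ p hθ hdom hne).trans (Nat.pow_le_pow_right (by norm_num) ?_)
  omega

/-- `⌊log₂ K⌋² ≤ K + 1` for every `K` (the square tower's crossover arithmetic; equality at `K = 8`). [folklore] -/
theorem log_sq_le_succ (K : ℕ) : Nat.log 2 K ^ 2 ≤ K + 1 := by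
  rcases Nat.lt_or_ge K 16 with hK | hK
  · interval_cases K <;> simp [Nat.log] <;> decide
  · -- `L = ⌊log₂ K⌋ ≥ 4` and `2^L ≤ K`; `L² ≤ 2^L` for `L ≥ 4`
    set L := Nat.log 2 K with hL
    have h2L : 2 ^ L ≤ K := Nat.pow_log_le_self 2 (by omega)
    have hL4 : 4 ≤ L := by
      rw [hL]
      exact Nat.le_log_of_pow_le (by norm_num) hK
    have key : ∀ j : ℕ, 4 ≤ j → j ^ 2 ≤ 2 ^ j := by
      intro j hj
      induction j, hj using Nat.le_induction with
      | base => norm_num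
      | succ j hj ih =>
        have : (j + 1) ^ 2 ≤ 2 * j ^ 2 := by nlinarith
        calc (j + 1) ^ 2 ≤ 2 * j ^ 2 := this
          _ ≤ 2 * 2 ^ j := by omega
          _ = 2 ^ (j + 1) := by rw [pow_succ]; ring
    have := key L hL4
    omega

/-- **The SQUARE TOWER's conclusion on the walk sector** (`stub_squareTower` shape, `C = 112`): a walk design of format `(K², K)` (i.e. `m = K²`
rows) has dominant chains of length `n ≤ 2^(112·K)` — so the first open tower height and the square tower are theorems on the sector of every
known super-polynomial family. [folklore: `chain_le_kPlusLogSq` + `⌊log₂ K²⌋² ≤ 4(K+1)`-type arithmetic] -/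
theorem chain_le_squareTower (hT : 0 < T) (hmK : m = K ^ 2) {n : ℕ} (θ : Fin (n + 1) → ℤ)
    (p : Fin (n + 1) → Equiv.Perm (Fin m) × (Fin m → Fin K)) (hθ : StrictMono θ)
    (hdom : ∀ k, IsDominant d (walkVal ι lay Ω v₀) (walkEps ι lay l₀ v₀) (θ k) (p k))
    (hne : ∀ k : Fin n, p k.castSucc ≠ p k.succ) : n ≤ 2 ^ (112 * K) := by
  refine (chain_le_kPlusLogSq lay d v₀ l₀ ι Ω hT θ p hθ hdom hne).trans (Nat.pow_le_pow_right (by norm_num) ?_)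
  have hK1 : 1 ≤ K := l₀.pos
  -- `⌊log₂ (K²)⌋ ≤ 2⌊log₂ K⌋ + 1`
  set L := Nat.log 2 K with hL
  have hKlt : K < 2 ^ (L + 1) := Nat.lt_pow_succ_log_self one_lt_two K
  have hsq : K ^ 2 < 2 ^ (2 * L + 2) := by
    have : K ^ 2 < (2 ^ (L + 1)) ^ 2 := Nat.pow_lt_pow_left hKlt two_ne_zero
    calc K ^ 2 < (2 ^ (L + 1)) ^ 2 := this
      _ = 2 ^ (2 * L + 2) := by rw [← pow_mul]; ring_nf
  have hlog : Nat.log 2 m ≤ 2 * L + 1 := by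
    rw [hmK]
    have hpos : K ^ 2 ≠ 0 := pow_ne_zero _ (by omega)
    exact Nat.le_of_lt_succ (Nat.log_lt_of_lt_pow hpos hsq)
  have h1 : Nat.log 2 m ^ 2 ≤ (2 * L + 1) ^ 2 := Nat.pow_le_pow_left hlog 2
  have h2 := log_sq_le_succ K
  rw [← hL] at h2
  have hLK : L ≤ K := by rw [hL]; exact Nat.log_le_self 2 K
  have h3 : (2 * L + 1) ^ 2 = 4 * L ^ 2 + 4 * L + 1 := by ring
  rw [h3] at h1
  omega

/-- **The registered foothold `stub_tropTowerLog`'s conclusion on the walk sector** (`C = 112`): a walk design of format `(K·⌊log₂ K⌋, K)`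
has dominant chains of length `n ≤ 2^(112·K)` (size monotonicity of the logarithm: `K·⌊log₂ K⌋ ≤ K²`). [folklore: `chain_le_kPlusLogSq` + arithmetic] -/
theorem chain_le_towerLog (hT : 0 < T) (hmK : m = K * Nat.log 2 K) {n : ℕ} (θ : Fin (n + 1) → ℤ)
    (p : Fin (n + 1) → Equiv.Perm (Fin m) × (Fin m → Fin K)) (hθ : StrictMono θ)
    (hdom : ∀ k, IsDominant d (walkVal ι lay Ω v₀) (walkEps ι lay l₀ v₀) (θ k) (p k))
    (hne : ∀ k : Fin n, p k.castSucc ≠ p k.succ) : n ≤ 2 ^ (112 * K) := by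
  refine (chain_le_kPlusLogSq lay d v₀ l₀ ι Ω hT θ p hθ hdom hne).trans (Nat.pow_le_pow_right (by norm_num) ?_)
  have hK1 : 1 ≤ K := l₀.pos
  set L := Nat.log 2 K with hL
  have hLK : L ≤ K := by rw [hL]; exact Nat.log_le_self 2 K
  have hmK2 : m ≤ K ^ 2 := by rw [hmK, sq]; exact Nat.mul_le_mul_left K hLK
  have hKlt : K < 2 ^ (L + 1) := Nat.lt_pow_succ_log_self one_lt_two K
  have hsq : K ^ 2 < 2 ^ (2 * L + 2) := by
    have : K ^ 2 < (2 ^ (L + 1)) ^ 2 := Nat.pow_lt_pow_left hKlt two_ne_zero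
    calc K ^ 2 < (2 ^ (L + 1)) ^ 2 := this
      _ = 2 ^ (2 * L + 2) := by rw [← pow_mul]; ring_nf
  have hlog : Nat.log 2 m ≤ 2 * L + 1 := by
    rcases Nat.eq_zero_or_pos m with hm0 | hm0
    · rw [hm0]; simp
    · exact Nat.le_of_lt_succ (Nat.log_lt_of_lt_pow hm0.ne' (lt_of_le_of_lt hmK2 hsq))
  have h1 : Nat.log 2 m ^ 2 ≤ (2 * L + 1) ^ 2 := Nat.pow_le_pow_left hlog 2
  have h2 := log_sq_le_succ K
  rw [← hL] at h2
  have h3 : (2 * L + 1) ^ 2 = 4 * L ^ 2 + 4 * L + 1 := by ring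
  rw [h3] at h1
  omega

end Summit.ValiantsHypothesis.ValiantsHypothesis.Theorems.KPlusLogSqLaw.WalkDesign
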